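import Mathlib
import Literature.Analysis.PDE.NearInverseSquareFarPowerFacts

/-!
# Energy-seminorm closeness of the true far kernel data to the exact powers

Analysis/PDE support file (everything proved). For the smooth `ι = 1/x` on `[½,∞)`, a continuous
`W ≥ 0` that is `ε x^{-5/2}`-close to `n(n+1)/x²` on `[½,∞)` (`ε ≤ ¼`), and a global `C²` function
`B(t,x)` whose Cauchy data on `[1,∞)` are `(f, 0)` (position type) resp. `(0, f)` (velocity type)
with `|f − x^{-m}| ≤ E x^{-m-1/2}`, `|f' + m x^{-m-1}| ≤ E x^{-m-3/2}`:
* `position_closeness`: `√∫_{x>1} [((ι^m − B(0,·))')² + W(ι^m − B(0,·))² + (∂ₜB(0,·))²] ≤ E (n+2)`;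
* `velocity_closeness`: `√∫_{x>1} [(B(0,·)')² + W B(0,·)² + (ι^m − ∂ₜB(0,·))²] ≤ E` (`m ≥ 1`);
* `position_reference_lower`, `velocity_reference_lower`: the exact data have seminorm at least
  `½` resp. `1/(2(n+1))` (`1 ≤ m ≤ n` for the velocity, `n ≥ 1` for the position).
These turn the pointwise asymptotics of `NearInverseSquareFarKernelElements` into the relative
closeness hypotheses of `NearInverseSquareFarPowerAdapter.kernelFamily_of_powerFamily`
(route PhotonSphereChannels, `FixedModeChannels`, stmt-FinalStateConjecture-10048). Folklore.
-/

noncomputable section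

namespace Literature.Analysis.PDE

open Set Filter MeasureTheory Finset Literature.Analysis.ODE
open scoped Topology

variable {ι : ℝ → ℝ}

/-- `rpow` bookkeeping on `(0,∞)`: `ι x ^ p = x^{-p}`, squares of powers, monotonicity.
[folklore] -/
theorem iota_rpow_facts (hιeq : ∀ x : ℝ, 1 / 2 ≤ x → ι x = x⁻¹) {x : ℝ} (hx : 1 ≤ x) :
    (∀ p : ℕ, ι x ^ p = x ^ (-(p : ℝ))) ∧ (∀ r : ℝ, (x ^ r) ^ 2 = x ^ (2 * r)) ∧
    (∀ r s : ℝ, x ^ r * x ^ s = x ^ (r + s)) ∧ (∀ r s : ℝ, r ≤ s → x ^ r ≤ x ^ s) ∧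
    (∀ r : ℝ, 0 < x ^ r) := by
  have hx0 : 0 < x := by linarith
  refine ⟨fun p => ?_, fun r => ?_, fun r s => (Real.rpow_add hx0 r s).symm,
    fun r s h => Real.rpow_le_rpow_of_exponent_le hx h, fun r => Real.rpow_pos_of_pos hx0 r⟩
  · rw [hιeq x (by linarith), inv_pow, Real.rpow_neg hx0.le, Real.rpow_natCast]
  · rw [← Real.rpow_natCast, ← Real.rpow_mul hx0.le]; push_cast; ring_nf

/-- `∫_{x>1} x^{-s} dx = 1/(s−1)` for `s > 1`, and the integrand is integrable. [folklore] -/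
theorem integral_Ioi_one_rpow_neg {s : ℝ} (hs : 1 < s) :
    IntegrableOn (fun x : ℝ => x ^ (-s)) (Ioi 1) ∧ ∫ x in Ioi (1 : ℝ), x ^ (-s) = 1 / (s - 1) := by
  refine ⟨integrableOn_Ioi_rpow_of_lt (by linarith) one_pos, ?_⟩
  rw [integral_Ioi_rpow_of_lt (by linarith) one_pos, Real.one_rpow]
  have h1 : -s + 1 ≠ 0 := (sub_neg.2 hs |> fun h => by linarith [h] : -s + 1 < 0).ne
  have h2 : s - 1 ≠ 0 := (sub_pos.2 hs).ne'
  rw [div_eq_div_iff h1 h2]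
  ring

/-- **Position-type closeness.** See the module docstring. [folklore] -/
theorem position_closeness (hι : ContDiff ℝ (⊤ : ℕ∞) ι) (hιeq : ∀ x : ℝ, 1 / 2 ≤ x → ι x = x⁻¹)
    {W : ℝ → ℝ} (hW0 : ∀ x, 0 ≤ W x) {n : ℕ} {ε : ℝ} (hε0 : 0 ≤ ε) (hε : ε ≤ 1 / 4)
    (hclose : ∀ x : ℝ, 1 / 2 ≤ x → |W x - (n : ℝ) * ((n : ℝ) + 1) / x ^ 2| ≤ ε * x ^ (-(5 : ℝ) / 2))
    (m : ℕ) {B : ℝ → ℝ → ℝ} (hB : ContDiff ℝ 2 (Function.uncurry B)) {f f' : ℝ → ℝ} {E : ℝ}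
    (hE : 0 ≤ E)
    (hdata : ∀ x, 1 ≤ x → B 0 x = f x ∧ deriv (fun τ => B τ x) 0 = 0 ∧ deriv (B 0) x = f' x)
    (hf : ∀ x : ℝ, 1 ≤ x → |f x - x ^ (-(m : ℝ))| ≤ E * x ^ (-(m : ℝ) - 1 / 2) ∧
      |f' x + m * x ^ (-(m : ℝ) - 1)| ≤ E * x ^ (-(m : ℝ) - 3 / 2)) :
    Real.sqrt (∫ x in Ioi 1, (deriv (fun y => ι y ^ m - B 0 y) x ^ 2
      + W x * (ι x ^ m - B 0 x) ^ 2 + deriv (fun τ => B τ x) 0 ^ 2)) ≤ E * ((n : ℝ) + 2) := by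
  have hB0d : Differentiable ℝ (B 0) :=
    ((hB.comp (contDiff_const.prodMk contDiff_id)).differentiable (by norm_num))
  set C : ℝ := (n : ℝ) * ((n : ℝ) + 1) + 2 with hC
  -- pointwise bound on `(1,∞)`
  have hpt : ∀ x : ℝ, 1 < x → deriv (fun y => ι y ^ m - B 0 y) x ^ 2
      + W x * (ι x ^ m - B 0 x) ^ 2 + deriv (fun τ => B τ x) 0 ^ 2
        ≤ E ^ 2 * C * x ^ (-(2 * (m : ℝ) + 3)) := by
    intro x hx
    have hx1 : (1 : ℝ) ≤ x := hx.le
    obtain ⟨hιp, hsq, hmul, -, hpos⟩ := iota_rpow_facts hιeq hx1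
    obtain ⟨hB0, hBt, hBx⟩ := hdata x hx1
    obtain ⟨h1, h2⟩ := hf x hx1
    obtain ⟨-, -, hW3, -⟩ := nearInverseSquare_pointwise hε0 hε hW0 hclose hx1
    have hx0 : 0 < x := by linarith
    -- the derivative
    have hd : deriv (fun y => ι y ^ m - B 0 y) x = -(f' x + m * x ^ (-(m : ℝ) - 1)) := by
      rw [deriv_fun_sub ((hι.pow m).differentiable (by simp) x) (hB0d x), deriv_iota_pow hιeq m
        (by linarith), hBx, hιp (m + 1)]
      push_cast; ring_nf
    have hsub : ι x ^ m - B 0 x = -(f x - x ^ (-(m : ℝ))) := by rw [hB0, hιp m]; ring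
    rw [hd, hsub, hBt, neg_sq, neg_sq]
    have hW' : W x ≤ ((n : ℝ) * ((n : ℝ) + 1) + 1) * x ^ (-(2 : ℝ)) := by
      rw [Real.rpow_neg hx0.le, Real.rpow_two]
      calc W x ≤ (n : ℝ) * ((n : ℝ) + 1) / x ^ 2 + ε * (x ^ 2)⁻¹ := hW3
        _ ≤ ((n : ℝ) * ((n : ℝ) + 1) + 1) * (x ^ 2)⁻¹ := by
            rw [div_eq_mul_inv]; nlinarith [inv_pos.2 (pow_pos hx0 2)]
    have e1 : (f' x + m * x ^ (-(m : ℝ) - 1)) ^ 2 ≤ E ^ 2 * x ^ (-(2 * (m : ℝ) + 3)) := by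
      calc (f' x + m * x ^ (-(m : ℝ) - 1)) ^ 2 = |f' x + m * x ^ (-(m : ℝ) - 1)| ^ 2 := (sq_abs _).symm
        _ ≤ (E * x ^ (-(m : ℝ) - 3 / 2)) ^ 2 := pow_le_pow_left₀ (abs_nonneg _) h2 2
        _ = E ^ 2 * x ^ (-(2 * (m : ℝ) + 3)) := by rw [mul_pow, hsq]; ring_nf
    have e2 : (f x - x ^ (-(m : ℝ))) ^ 2 ≤ E ^ 2 * x ^ (-(2 * (m : ℝ) + 1)) := by
      calc (f x - x ^ (-(m : ℝ))) ^ 2 = |f x - x ^ (-(m : ℝ))| ^ 2 := (sq_abs _).symm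
        _ ≤ (E * x ^ (-(m : ℝ) - 1 / 2)) ^ 2 := pow_le_pow_left₀ (abs_nonneg _) h1 2
        _ = E ^ 2 * x ^ (-(2 * (m : ℝ) + 1)) := by rw [mul_pow, hsq]; ring_nf
    have e3 : W x * (f x - x ^ (-(m : ℝ))) ^ 2
        ≤ ((n : ℝ) * ((n : ℝ) + 1) + 1) * E ^ 2 * x ^ (-(2 * (m : ℝ) + 3)) := by
      calc W x * (f x - x ^ (-(m : ℝ))) ^ 2
          ≤ (((n : ℝ) * ((n : ℝ) + 1) + 1) * x ^ (-(2 : ℝ))) * (E ^ 2 * x ^ (-(2 * (m : ℝ) + 1))) :=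
            mul_le_mul hW' e2 (sq_nonneg _) (by positivity)
        _ = ((n : ℝ) * ((n : ℝ) + 1) + 1) * E ^ 2 * (x ^ (-(2 : ℝ)) * x ^ (-(2 * (m : ℝ) + 1))) := by
            ring
        _ = _ := by rw [hmul]; ring_nf
    calc (f' x + m * x ^ (-(m : ℝ) - 1)) ^ 2 + W x * (f x - x ^ (-(m : ℝ))) ^ 2 + (0 : ℝ) ^ 2
        ≤ E ^ 2 * x ^ (-(2 * (m : ℝ) + 3))
          + ((n : ℝ) * ((n : ℝ) + 1) + 1) * E ^ 2 * x ^ (-(2 * (m : ℝ) + 3)) := by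
          rw [show (0 : ℝ) ^ 2 = 0 by norm_num, add_zero]; exact add_le_add e1 e3
      _ = E ^ 2 * C * x ^ (-(2 * (m : ℝ) + 3)) := by rw [hC]; ring
  -- integrate
  obtain ⟨hgi, hgv⟩ := integral_Ioi_one_rpow_neg (s := 2 * (m : ℝ) + 3)
    (by linarith [(m.cast_nonneg : (0 : ℝ) ≤ m)])
  have hint : (∫ x in Ioi 1, (deriv (fun y => ι y ^ m - B 0 y) x ^ 2
      + W x * (ι x ^ m - B 0 x) ^ 2 + deriv (fun τ => B τ x) 0 ^ 2))
        ≤ ∫ x in Ioi (1 : ℝ), E ^ 2 * C * x ^ (-(2 * (m : ℝ) + 3)) := by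
    refine integral_mono_of_nonneg ?_ (hgi.const_mul _) ?_
    · exact ae_of_all _ fun x => add_nonneg (add_nonneg (sq_nonneg _) (mul_nonneg (hW0 x) (sq_nonneg _)))
        (sq_nonneg _)
    · exact (ae_restrict_iff' measurableSet_Ioi).2 (ae_of_all _ fun x hx => hpt x hx)
  rw [integral_const_mul, hgv] at hint
  have hm0 : (0 : ℝ) ≤ m := m.cast_nonneg
  have hval : E ^ 2 * C * (1 / (2 * (m : ℝ) + 3 - 1)) ≤ (E * ((n : ℝ) + 2)) ^ 2 := by
    have h1 : 1 / (2 * (m : ℝ) + 3 - 1) ≤ 1 := by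
      rw [div_le_one (by linarith)]; linarith
    have h2 : C ≤ ((n : ℝ) + 2) ^ 2 := by rw [hC]; nlinarith
    calc E ^ 2 * C * (1 / (2 * (m : ℝ) + 3 - 1)) ≤ E ^ 2 * C * 1 :=
          mul_le_mul_of_nonneg_left h1 (by positivity)
      _ ≤ E ^ 2 * ((n : ℝ) + 2) ^ 2 := by rw [mul_one]; exact mul_le_mul_of_nonneg_left h2 (sq_nonneg _)
      _ = (E * ((n : ℝ) + 2)) ^ 2 := by ring
  calc Real.sqrt _ ≤ Real.sqrt ((E * ((n : ℝ) + 2)) ^ 2) := Real.sqrt_le_sqrt (hint.trans hval)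
    _ = E * ((n : ℝ) + 2) := Real.sqrt_sq (by positivity)

/-- **Velocity-type closeness.** See the module docstring. [folklore] -/
theorem velocity_closeness (hιeq : ∀ x : ℝ, 1 / 2 ≤ x → ι x = x⁻¹)
    {W : ℝ → ℝ} (hW0 : ∀ x, 0 ≤ W x) {m : ℕ} (hm : 1 ≤ m) {B : ℝ → ℝ → ℝ} {f : ℝ → ℝ} {E : ℝ}
    (hE : 0 ≤ E)
    (hdata : ∀ x, 1 ≤ x → B 0 x = 0 ∧ deriv (fun τ => B τ x) 0 = f x ∧ deriv (B 0) x = 0)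
    (hf : ∀ x : ℝ, 1 ≤ x → |f x - x ^ (-(m : ℝ))| ≤ E * x ^ (-(m : ℝ) - 1 / 2)) :
    Real.sqrt (∫ x in Ioi 1, (deriv (B 0) x ^ 2 + W x * B 0 x ^ 2
      + (ι x ^ m - deriv (fun τ => B τ x) 0) ^ 2)) ≤ E := by
  have hpt : ∀ x : ℝ, 1 < x → deriv (B 0) x ^ 2 + W x * B 0 x ^ 2
      + (ι x ^ m - deriv (fun τ => B τ x) 0) ^ 2 ≤ E ^ 2 * x ^ (-(2 * (m : ℝ) + 1)) := by
    intro x hx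
    have hx1 : (1 : ℝ) ≤ x := hx.le
    obtain ⟨hιp, hsq, -, -, -⟩ := iota_rpow_facts hιeq hx1
    obtain ⟨hB0, hBt, hBx⟩ := hdata x hx1
    have h1 := hf x hx1
    rw [hB0, hBt, hBx, hιp m]
    have hsub : x ^ (-(m : ℝ)) - f x = -(f x - x ^ (-(m : ℝ))) := by ring
    rw [hsub, neg_sq]
    calc (0 : ℝ) ^ 2 + W x * 0 ^ 2 + (f x - x ^ (-(m : ℝ))) ^ 2 = |f x - x ^ (-(m : ℝ))| ^ 2 := by
          rw [sq_abs]; ring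
      _ ≤ (E * x ^ (-(m : ℝ) - 1 / 2)) ^ 2 := pow_le_pow_left₀ (abs_nonneg _) h1 2
      _ = E ^ 2 * x ^ (-(2 * (m : ℝ) + 1)) := by rw [mul_pow, hsq]; ring_nf
  have hm1 : (1 : ℝ) ≤ m := by exact_mod_cast hm
  obtain ⟨hgi, hgv⟩ := integral_Ioi_one_rpow_neg (s := 2 * (m : ℝ) + 1) (by linarith)
  have hint : (∫ x in Ioi 1, (deriv (B 0) x ^ 2 + W x * B 0 x ^ 2
      + (ι x ^ m - deriv (fun τ => B τ x) 0) ^ 2))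
        ≤ ∫ x in Ioi (1 : ℝ), E ^ 2 * x ^ (-(2 * (m : ℝ) + 1)) := by
    refine integral_mono_of_nonneg ?_ (hgi.const_mul _) ?_
    · exact ae_of_all _ fun x => add_nonneg (add_nonneg (sq_nonneg _) (mul_nonneg (hW0 x) (sq_nonneg _)))
        (sq_nonneg _)
    · exact (ae_restrict_iff' measurableSet_Ioi).2 (ae_of_all _ fun x hx => hpt x hx)
  rw [integral_const_mul, hgv] at hint
  have hval : E ^ 2 * (1 / (2 * (m : ℝ) + 1 - 1)) ≤ E ^ 2 := by
    have h1 : 1 / (2 * (m : ℝ) + 1 - 1) ≤ 1 := by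
      rw [div_le_one (by linarith)]; linarith
    calc E ^ 2 * (1 / (2 * (m : ℝ) + 1 - 1)) ≤ E ^ 2 * 1 := mul_le_mul_of_nonneg_left h1 (sq_nonneg _)
      _ = E ^ 2 := mul_one _
  calc Real.sqrt _ ≤ Real.sqrt (E ^ 2) := Real.sqrt_le_sqrt (hint.trans hval)
    _ = E := Real.sqrt_sq hE


/-- **The exact position data are not small**: `√∫_{x>1}[((ι^m)')² + W ι^{2m}] ≥ ½` (`n ≥ 1`).
[folklore] -/
theorem position_reference_lower (hι : ContDiff ℝ (⊤ : ℕ∞) ι)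
    (hιeq : ∀ x : ℝ, 1 / 2 ≤ x → ι x = x⁻¹) {W : ℝ → ℝ} (hW : Continuous W) (hW0 : ∀ x, 0 ≤ W x)
    {n : ℕ} (hn : 1 ≤ n) {ε : ℝ} (hε0 : 0 ≤ ε) (hε : ε ≤ 1 / 4)
    (hclose : ∀ x : ℝ, 1 / 2 ≤ x → |W x - (n : ℝ) * ((n : ℝ) + 1) / x ^ 2| ≤ ε * x ^ (-(5 : ℝ) / 2))
    (m : ℕ) :
    (1 / 2 : ℝ) ≤ Real.sqrt (∫ x in Ioi 1, (deriv (fun y => ι y ^ m) x ^ 2 + W x * (ι x ^ m) ^ 2)) := by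
  refine (Real.le_sqrt' (by norm_num)).2 ?_
  obtain ⟨iA, -⟩ := integrableOn_deriv_iota_pow_sq hι hιeq m
  obtain ⟨iB, -⟩ := integrableOn_W_mul_iota_pow_sq hι hιeq hW hε0 hε hW0 hclose m
  have hsum : (∫ x in Ioi 1, (deriv (fun y => ι y ^ m) x ^ 2 + W x * (ι x ^ m) ^ 2))
      = (∫ x in Ioi 1, deriv (fun y => ι y ^ m) x ^ 2) + ∫ x in Ioi 1, W x * (ι x ^ m) ^ 2 :=
    integral_add iA iB
  have hBnn : 0 ≤ ∫ x in Ioi 1, W x * (ι x ^ m) ^ 2 :=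
    setIntegral_nonneg measurableSet_Ioi fun x _ => mul_nonneg (hW0 x) (sq_nonneg _)
  have hAnn : 0 ≤ ∫ x in Ioi 1, deriv (fun y => ι y ^ m) x ^ 2 :=
    setIntegral_nonneg measurableSet_Ioi fun x _ => sq_nonneg _
  rcases Nat.eq_zero_or_pos m with hm0 | hm1
  · -- `m = 0`: the potential term alone
    subst hm0
    have hg : IntegrableOn (fun x : ℝ => (n : ℝ) * ((n : ℝ) + 1) * x ^ (-(2 : ℝ))
        - ε * x ^ (-((5 : ℝ) / 2))) (Ioi 1) :=
      ((integral_Ioi_one_rpow_neg (s := 2) (by norm_num)).1.const_mul _).sub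
        ((integral_Ioi_one_rpow_neg (s := (5 : ℝ) / 2) (by norm_num)).1.const_mul _)
    have hgv : (∫ x in Ioi (1 : ℝ), ((n : ℝ) * ((n : ℝ) + 1) * x ^ (-(2 : ℝ))
        - ε * x ^ (-((5 : ℝ) / 2)))) = (n : ℝ) * ((n : ℝ) + 1) * (1 / (2 - 1)) - ε * (1 / (5 / 2 - 1)) := by
      rw [integral_sub ((integral_Ioi_one_rpow_neg (s := 2) (by norm_num)).1.const_mul _)
        ((integral_Ioi_one_rpow_neg (s := (5 : ℝ) / 2) (by norm_num)).1.const_mul _),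
        integral_const_mul, integral_const_mul, (integral_Ioi_one_rpow_neg (s := 2) (by norm_num)).2,
        (integral_Ioi_one_rpow_neg (s := (5 : ℝ) / 2) (by norm_num)).2]
    have hWge : (∫ x in Ioi (1 : ℝ), ((n : ℝ) * ((n : ℝ) + 1) * x ^ (-(2 : ℝ))
        - ε * x ^ (-((5 : ℝ) / 2)))) ≤ ∫ x in Ioi 1, W x * (ι x ^ 0) ^ 2 := by
      refine setIntegral_mono_on hg iB measurableSet_Ioi fun x hx => ?_
      have hx1 : (1 : ℝ) ≤ x := le_of_lt hx
      have hx0 : 0 < x := by linarith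
      have hc := (abs_le.1 (hclose x (by linarith))).1
      rw [pow_zero, one_pow, mul_one, Real.rpow_neg hx0.le, Real.rpow_two,
        show (-((5 : ℝ) / 2)) = -(5 : ℝ) / 2 by ring]
      have e : (n : ℝ) * ((n : ℝ) + 1) / x ^ 2 = (n : ℝ) * ((n : ℝ) + 1) * (x ^ 2)⁻¹ :=
        div_eq_mul_inv _ _
      linarith
    have hn2 : (2 : ℝ) ≤ (n : ℝ) * ((n : ℝ) + 1) := by
      have : (1 : ℝ) ≤ n := by exact_mod_cast hn
      nlinarith
    rw [hsum]
    have : (1 / 2 : ℝ) ^ 2 ≤ ∫ x in Ioi 1, W x * (ι x ^ 0) ^ 2 := by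
      refine le_trans ?_ hWge
      rw [hgv]; norm_num; nlinarith
    linarith
  · -- `m ≥ 1`: the derivative term alone
    have hm1' : (1 : ℝ) ≤ m := by exact_mod_cast hm1
    have hAv : (∫ x in Ioi 1, deriv (fun y => ι y ^ m) x ^ 2)
        = (m : ℝ) ^ 2 * (1 / (2 * (m : ℝ) + 2 - 1)) := by
      rw [← (integral_Ioi_one_rpow_neg (s := 2 * (m : ℝ) + 2) (by linarith)).2, ← integral_const_mul]
      refine setIntegral_congr_fun measurableSet_Ioi fun x hx => ?_
      have hx1 : (1 : ℝ) ≤ x := le_of_lt hx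
      obtain ⟨hιp, hsq, -, -, -⟩ := iota_rpow_facts hιeq hx1
      rw [deriv_iota_pow hιeq m (by linarith), mul_pow, hιp (m + 1), hsq]
      push_cast; ring_nf
    have hA : (1 / 2 : ℝ) ^ 2 ≤ ∫ x in Ioi 1, deriv (fun y => ι y ^ m) x ^ 2 := by
      rw [hAv, show 2 * (m : ℝ) + 2 - 1 = 2 * m + 1 by ring, mul_one_div,
        le_div_iff₀ (by linarith)]
      nlinarith
    rw [hsum]; linarith

/-- **The exact velocity data are not small**: `√∫_{x>1} ι^{2m} ≥ 1/(2(n+1))` for `1 ≤ m ≤ n`.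
[folklore] -/
theorem velocity_reference_lower (hιeq : ∀ x : ℝ, 1 / 2 ≤ x → ι x = x⁻¹) {m n : ℕ} (hm : 1 ≤ m)
    (hmn : m ≤ n) :
    1 / (2 * ((n : ℝ) + 1)) ≤ Real.sqrt (∫ x in Ioi 1, (ι x ^ m) ^ 2) := by
  refine (Real.le_sqrt' (by positivity)).2 ?_
  have hm1 : (1 : ℝ) ≤ m := by exact_mod_cast hm
  have hmn' : (m : ℝ) ≤ n := by exact_mod_cast hmn
  have hv : (∫ x in Ioi 1, (ι x ^ m) ^ 2) = 1 / (2 * (m : ℝ) - 1) := by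
    rw [← (integral_Ioi_one_rpow_neg (s := 2 * (m : ℝ)) (by linarith)).2]
    refine setIntegral_congr_fun measurableSet_Ioi fun x hx => ?_
    obtain ⟨hιp, hsq, -, -, -⟩ := iota_rpow_facts hιeq (le_of_lt hx)
    rw [hιp m, hsq]; ring_nf
  rw [hv, div_pow, one_pow, one_div_le_one_div (by positivity) (by linarith)]
  nlinarith

end Literature.Analysis.PDE
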